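import Literature.NumberTheory.ModularSymbols.FullLevelHomologySpreadKernel
import Literature.NumberTheory.ModularSymbols.FullLevelHomologySpreadLatticeHecke
import Literature.NumberTheory.ModularSymbols.PeriodHomologyGroupPresentationProofs
import HarnessLib

/-!
# Multiplicity one for the K-line from an integral Hecke quasi-projector

Topic `Literature/NumberTheory/ModularSymbols`; namespace `Literature.NumberTheory.ModularSymbols.FullLevel`; sequel of
`FullLevelHomologySpreadKernel` (`MultOneHyp`, `spreadPeriod_eq_zero_of_cuspidal_eq_zero`), `FullLevelHomologySpreadLatticeHecke`
and `FullLevelHomologyHeckeComparison` (`heckeT`, `heckeTInvariants`, `heckeComparison`).  Proved theorems only (no named fact,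
no `sorry`, no instance, no notation); Knapp's presentation enters through the tree's THEOREM
`periodFunctional_ker_le_ellipticParabolic_sup_commutator_holds`.

THE REDUCTION.  Let `f ∈ S₂(Γ₀(p²M))` and let `θ` be an element of the `ℤ`-subalgebra of `End_k H(p²M; k)` generated by the
Hecke operators `T_q` (`q ≠ p` prime) — an INTEGRAL HECKE QUASI-PROJECTOR for `f` if, for some `c ∈ ℤ`,
`θ` kills `ker(periodClassK f)` and `periodClassK f ∘ θ = c · periodClassK f` (for a newform `f` with multiplicity one such a
`θ = c·e_f` exists: the Hecke algebra `⊗ ℚ` is commutative semisimple and the `f`-eigenspace of the `T_q`, `q ∤ pM`, is a line).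
Every such `θ` LIFTS to the full-level carrier (`heckeLift_of_mem_adjoin`: a `GL₂(ℤ/p)`-equivariant endomorphism `θ̃` of
`H₁(Γ₀(M), k[GL₂(ℤ/p)])` with `dictionary ∘ e_{T̃} ∘ θ̃ = θ ∘ dictionary ∘ e_{T̃}`, by `heckeT_H1carrierRep` and `heckeComparison`),
and then **`multOneHyp_of_heckeProjector`**: if `c` is a non-zero-divisor on `k ⊗ Λ_f`, `MultOneHyp k p M hpM f` holds — for
`z` invariant with `Φ(z) = 0` (`Φ = torusPeriodClass f`), `c·Φ(e_{T̃}(g·z)) = Φ(e_{T̃}(g·θ̃z))` and `e_{T̃}θ̃z ∈ ker(dictionary)`,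
which the spread period map kills (`spreadPeriod_eq_zero_of_cuspidal_eq_zero`, `12 ∈ kˣ`).

Consumer: route BSD/TeichmullerTwistDescent, crux K (hypothesis `hM1` of
`Summit.…TeichmullerTwistDescent.KOfCarrier.twistedPeriodLatticeSaturation_of_carrier`).

## References
* A. Ash, G. Stevens, Duke Math. J. 53 (1986), §1 (1.2)–(1.4) (Hecke equivariance of the Shapiro dictionary). [AshStevens1986]
* G. Shimura, *Introduction to the arithmetic theory of automorphic functions* (1971), Thm. 3.41, §3.5 (Hecke algebra on
  `H₁`; commutativity and semisimplicity). [Shimura1971]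
* F. Diamond, J. Shurman, *A First Course in Modular Forms* (2005), §5.8 and Thm. 6.5.4 (strong multiplicity one / newforms).
  [DiamondShurman2005]
-/

noncomputable section

namespace Literature.NumberTheory.ModularSymbols

namespace FullLevel

open scoped MatrixGroups TensorProduct
open CategoryTheory CongruenceSubgroup groupHomology Finsupp Matrix
open Literature.Algebra.Homology
open Literature.NumberTheory.EllipticCurves.ModularForms

variable (k : Type) [CommRing k] (p M : ℕ) [Fact p.Prime] (hpM : Nat.Coprime p M) [NeZero M] [NeZero (p ^ 2 * M)]
  [Fintype (diagTorus (ZMod p))] [Invertible (Fintype.card (diagTorus (ZMod p)) : k)]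

/-- The generating set of downstairs Hecke operators the K-line can lift: `{T_q : q ≠ p prime}` on `H(p²M; k)`.
(A `Set` of endomorphisms, with body; the `ℤ`-subalgebra it generates is `Algebra.adjoin ℤ (heckeGenSet k p M)`.)
[cite: AshStevens1986, §1 (1.4)] -/
def heckeGenSet : Set (Module.End k (CuspidalHomologyHeckeModule (p ^ 2 * M) k)) :=
  {T | ∃ (q : ℕ) (hq : q.Prime), q ≠ p ∧ T = heckeOp (p ^ 2 * M) k q hq}

/-- **Liftability** of a downstairs endomorphism `θ` of `H(p²M; k)` to the full-level carrier: a `GL₂(ℤ/p)`-equivariant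
`θ̃ ∈ End_k H₁(Γ₀(M), k[GL₂(ℤ/p)])` with `dictionary(e_{T̃}(θ̃ y)) = θ(dictionary(e_{T̃} y))`. [cite: AshStevens1986, §1 (1.2)–(1.4)] -/
def HeckeLiftable (θ : Module.End k (CuspidalHomologyHeckeModule (p ^ 2 * M) k)) : Prop :=
  ∃ θc : H1carrier k p M →ₗ[k] H1carrier k p M,
    (∀ (g : GL (Fin 2) (ZMod p)) (y : H1carrier k p M), θc (H1carrierRep k p M g y) = H1carrierRep k p M g (θc y)) ∧
    ∀ y : H1carrier k p M,
      torusInvariantsToCuspidal k p M hpM (PermutationCoeff.toInvariants (redGL p M) (diagTorus (ZMod p)) (θc y)) =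
        θ (torusInvariantsToCuspidal k p M hpM (PermutationCoeff.toInvariants (redGL p M) (diagTorus (ZMod p)) y))

/-- `T_q` (`q ≠ p` prime) lifts: `θ̃ = T_q^{carrier}` (`heckeT_H1carrierRep`, `heckeTInvariants_toInvariants`, `heckeComparison`).
[cite: AshStevens1986, §1 (1.4)] -/
theorem heckeLiftable_heckeOp {q : ℕ} (hq : q.Prime) (hqp : q ≠ p) :
    HeckeLiftable k p M hpM (heckeOp (p ^ 2 * M) k q hq) := by
  haveI : NeZero q := ⟨hq.ne_zero⟩
  refine ⟨heckeT k p M hq hqp, fun g y => heckeT_H1carrierRep k p M hq hqp g y, fun y => ?_⟩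
  rw [← heckeTInvariants_toInvariants, heckeComparison p M hpM hq hqp k]

/-- Scalars lift. [cite: AshStevens1986, §1 (1.4)] -/
theorem heckeLiftable_algebraMap (r : ℤ) :
    HeckeLiftable k p M hpM (algebraMap ℤ (Module.End k (CuspidalHomologyHeckeModule (p ^ 2 * M) k)) r) := by
  refine ⟨algebraMap ℤ (Module.End k (H1carrier k p M)) r, fun g y => ?_, fun y => ?_⟩
  · rw [Algebra.algebraMap_eq_smul_one, LinearMap.smul_apply, LinearMap.smul_apply, Module.End.one_apply,
      Module.End.one_apply, map_zsmul]
  · rw [Algebra.algebraMap_eq_smul_one, Algebra.algebraMap_eq_smul_one, LinearMap.smul_apply, LinearMap.smul_apply,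
      Module.End.one_apply, Module.End.one_apply, map_zsmul, map_zsmul]

/-- Sums lift. [cite: AshStevens1986, §1 (1.4)] -/
theorem HeckeLiftable.add {θ₁ θ₂ : Module.End k (CuspidalHomologyHeckeModule (p ^ 2 * M) k)}
    (h₁ : HeckeLiftable k p M hpM θ₁) (h₂ : HeckeLiftable k p M hpM θ₂) : HeckeLiftable k p M hpM (θ₁ + θ₂) := by
  obtain ⟨c₁, hg₁, hd₁⟩ := h₁
  obtain ⟨c₂, hg₂, hd₂⟩ := h₂
  refine ⟨c₁ + c₂, fun g y => ?_, fun y => ?_⟩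
  · rw [LinearMap.add_apply, LinearMap.add_apply, hg₁, hg₂, map_add]
  · rw [LinearMap.add_apply, LinearMap.add_apply, map_add, map_add, hd₁, hd₂]

/-- Products lift. [cite: AshStevens1986, §1 (1.4)] -/
theorem HeckeLiftable.mul {θ₁ θ₂ : Module.End k (CuspidalHomologyHeckeModule (p ^ 2 * M) k)}
    (h₁ : HeckeLiftable k p M hpM θ₁) (h₂ : HeckeLiftable k p M hpM θ₂) : HeckeLiftable k p M hpM (θ₁ * θ₂) := by
  obtain ⟨c₁, hg₁, hd₁⟩ := h₁
  obtain ⟨c₂, hg₂, hd₂⟩ := h₂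
  refine ⟨c₁ * c₂, fun g y => ?_, fun y => ?_⟩
  · rw [Module.End.mul_apply, Module.End.mul_apply, hg₂, hg₁]
  · rw [Module.End.mul_apply, Module.End.mul_apply, hd₁, hd₂]

/-- **Every element of the `ℤ`-algebra generated by the `T_q` (`q ≠ p` prime) lifts to the carrier.**
[cite: AshStevens1986, §1 (1.2)–(1.4)] -/
theorem heckeLiftable_of_mem_adjoin {θ : Module.End k (CuspidalHomologyHeckeModule (p ^ 2 * M) k)}
    (hθ : θ ∈ Algebra.adjoin ℤ (heckeGenSet k p M)) : HeckeLiftable k p M hpM θ := by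
  induction hθ using Algebra.adjoin_induction with
  | mem T hT =>
    obtain ⟨q, hq, hqp, rfl⟩ := hT
    exact heckeLiftable_heckeOp k p M hpM hq hqp
  | algebraMap r => exact heckeLiftable_algebraMap k p M hpM r
  | add _ _ _ _ h₁ h₂ => exact HeckeLiftable.add k p M hpM h₁ h₂
  | mul _ _ _ _ h₁ h₂ => exact HeckeLiftable.mul k p M hpM h₁ h₂

omit [NeZero M] [NeZero (p ^ 2 * M)] [Fintype (diagTorus (ZMod p))] [Invertible (Fintype.card (diagTorus (ZMod p)) : k)] in
/-- An equivariant carrier endomorphism preserves the `T̃`-invariants. [cite: Brown1982, Ch. III §9] -/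
theorem mem_H1Invariants_of_equivariant {θc : H1carrier k p M →ₗ[k] H1carrier k p M}
    (hg : ∀ (g : GL (Fin 2) (ZMod p)) (y : H1carrier k p M), θc (H1carrierRep k p M g y) = H1carrierRep k p M g (θc y))
    {y : H1carrier k p M} (hy : y ∈ PermutationCoeff.H1Invariants k (redGL p M) (diagTorus (ZMod p))) :
    θc y ∈ PermutationCoeff.H1Invariants k (redGL p M) (diagTorus (ZMod p)) := by
  rw [PermutationCoeff.mem_H1Invariants_iff] at hy ⊢
  intro t
  have h := hg (t : GL (Fin 2) (ZMod p)) y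
  rw [H1carrierRep] at h
  rw [← h, hy t]

variable [Invertible (12 : k)]

/-- **Multiplicity one from an integral Hecke quasi-projector.**  If `θ ∈ ℤ⟨T_q : q ≠ p⟩ ⊂ End_k H(p²M; k)` kills
`ker(periodClassK f)` and satisfies `periodClassK f ∘ θ = c · periodClassK f` with `c` a non-zero-divisor on `k ⊗ Λ_f`, then
`MultOneHyp k p M hpM f`: for an invariant class `z` with `torusPeriodClass f z = 0`, every torus translate `e_{T̃}(g·z)` has
`torusPeriodClass` zero (with `z₀ = 0`).  [cite: AshStevens1986, §1 (1.3)–(1.4); Shimura1971, Thm. 3.41; DiamondShurman2005, Thm. 6.5.4] -/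
theorem multOneHyp_of_heckeProjector (f : CuspForm (Gamma0 (p ^ 2 * M)) 2)
    {θ : Module.End k (CuspidalHomologyHeckeModule (p ^ 2 * M) k)} (hθ : θ ∈ Algebra.adjoin ℤ (heckeGenSet k p M)) {c : k}
    (htf : ∀ x : k ⊗[ℤ] (periodLattice f).toIntSubmodule, c • x = 0 → x = 0)
    (hkill : ∀ w : CuspidalHomologyHeckeModule (p ^ 2 * M) k, periodClassK (p ^ 2 * M) k f w = 0 → θ w = 0)
    (hscale : ∀ w : CuspidalHomologyHeckeModule (p ^ 2 * M) k,
      periodClassK (p ^ 2 * M) k f (θ w) = c • periodClassK (p ^ 2 * M) k f w) :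
    MultOneHyp k p M hpM f := by
  intro z hz
  refine ⟨0, map_zero _, fun g => ?_⟩
  rw [Submodule.coe_zero, sub_zero]
  obtain ⟨θc, hg, hd⟩ := heckeLiftable_of_mem_adjoin k p M hpM hθ
  -- the lifted class `θ̃ z` is invariant and lies in the kernel of the dictionary
  have hinv : θc (z : H1carrier k p M) ∈ PermutationCoeff.H1Invariants k (redGL p M) (diagTorus (ZMod p)) :=
    mem_H1Invariants_of_equivariant k p M hg z.2
  have hker : torusInvariantsToCuspidal k p M hpM
      (PermutationCoeff.toInvariants (redGL p M) (diagTorus (ZMod p)) (θc (z : H1carrier k p M))) = 0 := by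
    rw [hd, PermutationCoeff.toInvariants_coe]
    exact hkill _ hz
  have hsp := (spreadPeriod_eq_zero_of_cuspidal_eq_zero k p M hpM periodFunctional_ker_le_ellipticParabolic_sup_commutator_holds
    f 1 _ hker).1
  rw [PermutationCoeff.coe_toInvariants, PermutationCoeff.avgProj_eq_self _ _ hinv] at hsp
  have hg' := congrFun hsp g
  rw [spreadPeriod, PermutationCoeff.spread_apply, Pi.zero_apply] at hg'
  -- `c · Φ(e(g·z)) = Φ(e(g·θ̃z)) = 0`
  apply htf
  have e1 : c • torusPeriodClass k p M hpM f
      (PermutationCoeff.toInvariants (redGL p M) (diagTorus (ZMod p)) (H1carrierRep k p M g (z : H1carrier k p M))) =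
      torusPeriodClass k p M hpM f
        (PermutationCoeff.toInvariants (redGL p M) (diagTorus (ZMod p)) (θc (H1carrierRep k p M g (z : H1carrier k p M)))) := by
    rw [torusPeriodClass, LinearMap.comp_apply, LinearMap.comp_apply, hd, hscale]
  rw [e1, hg]
  exact hg'

end FullLevel

end Literature.NumberTheory.ModularSymbols
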